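import Mathlib
import Summits.Ventures.HodgeRepro2.T6N42Rich
import Summits.Ventures.HodgeRepro2.T6N42FlathDatum
import Summits.Ventures.HodgeRepro2.T6N42FlathLift
import Summits.Ventures.HodgeRepro2.T6N42FlathLiftRead
import Summits.Ventures.HodgeRepro2.T6N42FlathLiftHost
import Summits.Ventures.HodgeRepro2.T6N42FlathLiftToy

/-!
# T6N42RichHost — THE HOST INSTANCE SHAPE of the N4.2 rich datum: `N42Rich` ASSEMBLED from the
Flath reading (`hIS`) and the first-lift reading (`hFL`), and, on the N3 side's carriers, from ONE
first-lift side (owner t6-p5)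

The rich datum `N42Rich` (`T6N42Rich.lean`) carries the N4.2 datum with its four standing facts
(`irreducibleSmooth`, `pos`, `typeIISizes`, `firstLift`). The Flath lane discharges two of them
from objects + laws: `hIS` = `FlathReading.irreducibleSmooth` (`T6N42FlathDatum.lean`) and `hFL`
= `FirstLiftReading.firstLift` (`T6N42FlathLiftRead.lean`); the other two are the sizes
`n = 2 > 0`, `n = 2 ≤ m = 3` of the datum's split places. This file ASSEMBLES them, in t6-p3's
objects/laws form (STATUS l. 12531), so that the host obligation of the WHOLE N4.2 block is
counted by name:

* `N42Readings D` (OBJECTS: a Flath reading + a first-lift reading) with laws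
  `N42Readings.IsReading` (the two readings' laws + the two sizes), and
  **`N42Rich.ofReadings Rd h : N42Rich`** with `ofReadings_toDatum : (ofReadings Rd h).toDatum = D`
  (`rfl`) — the rich datum of ANY datum with readings;
* on the N3 side's carriers `(LH, Hf, R, π₀)` (t6-p3's `N3SideRich`, in the tree since WAVE 1): `HostReadings D F hF`
  (OBJECTS, over a first-lift side `F` (`T6N42FlathLiftHost.FirstLiftSide`, TIER5 (E1) as data)
  under its laws `hF`: the Flath reading and the reading of `F`'s global datum at every non-split
  place) with laws `HostReadings.IsReading`; `toFirstLiftReading` / `toN42Readings` with their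
  laws; **`N42Rich.ofHost F hF S hS : N42Rich`**, `ofHost_toDatum` (`rfl`), and on the lead's
  carrier `NAut3` the N4.2 block of a composition from the host objects alone:
  `N42_side_host₃ M F hF S hS hM hGI : M.sA.d42.ThetaNonzeroEverywhere` (side B:
  `N42_sideB_host₃`). THE HOST OBLIGATION PER SIDE, final count: 2 DATA (`F : FirstLiftSide`,
  `S : HostReadings`) + 2 law binders (`hF : F.IsLift` — 5 laws; `hS : S.IsReading` — the Flath
  reading's laws, the two sizes, the readings' laws) + the two displays `hM` / `hGI` of the block
  (unchanged). No print beyond the Flath display consumed by `hIS`; no new mathematics — every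
  proof is a projection, `N42Main.N42_main`, or the two bridges.
* Non-vacuity (§10.5(ii)(c)/(d)): `toyReadOfSide` (the toy first-lift side's global datum read at
  the toy datum's one non-split place), `toyHostReadings : HostReadings toyFinitePlaces
  toyFirstLiftSide toyFirstLiftSide_isLift` with `toyHostReadings_isReading`, `toyRichOfHost :
  N42Rich` with `toyRichOfHost_toDatum : toyRichOfHost.toDatum = toyFinitePlaces` (`rfl`) and
  `toyFinitePlaces_thetaNonzeroEverywhere_host` — the toy's N4.2 conclusion re-derived from the
  host shape.

Proof lane (structures, `def`s, theorems; no display — nothing here is a printed statement).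
README §8(d): uses an L-value-free non-vanishing device: NO (TIER5 §N4.2 / §B, pre-02:16Z lines of
record, continued).

Filed in Tier-6 WAVE 1 as p438818 (proposed 2026-08-26T10:43:24Z, ACCEPTED, commit 316992ee332d);
this v2 differs from the filed bytes in this module docstring only (the staged-record wording
dropped; every declaration byte-identical to v1).
-/

namespace Summit.Ventures.HodgeRepro2.T6.N42Flath

open Summit.Ventures.HodgeRepro2
open Summit.Ventures.HodgeRepro2.T5DualPairSwap
open Summit.Ventures.HodgeRepro2.T5SplittingTwist
open Summit.Ventures.HodgeRepro2.T5TrivialPartner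
open Summit.Ventures.HodgeRepro2.T6.N42Defs
open Summit.Ventures.HodgeRepro2.T6.N42Datum
open TensorProduct

section Readings

variable {D : FinitePlacesDatum}

/-- THE N4.2 READINGS of a finite-places datum, OBJECTS: a Flath reading of its local `π`'s
(`hIS`) and a first-lift reading of its non-split places (`hFL`). Its laws are `IsReading`. -/
structure N42Readings (D : FinitePlacesDatum) where
  /-- the Flath reading (`hIS`) -/
  flath : FlathReading D
  /-- the first-lift reading (`hFL`) -/
  lift : FirstLiftReading D

namespace N42Readings

/-- The LAWS of the N4.2 readings: the Flath reading's laws, the two sizes of the split places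
(`0 < n`, `n ≤ m`) and the first-lift reading's laws. -/
structure IsReading (Rd : N42Readings D) : Prop where
  /-- the Flath reading's laws -/
  flath : Rd.flath.IsReading
  /-- `0 < n` at the split places -/
  pos : ∀ v, 0 < (D.splitDatum v).n
  /-- `n ≤ m` at the split places -/
  sizes : D.TypeIISizes
  /-- the first-lift reading's laws -/
  lift : Rd.lift.IsReading

/-- `hIS` from the readings. -/
theorem irreducibleSmooth (Rd : N42Readings D) (h : Rd.IsReading) : D.IrreducibleSmooth :=
  Rd.flath.irreducibleSmooth h.flath

/-- `hFL` from the readings. -/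
theorem firstLift (Rd : N42Readings D) (h : Rd.IsReading) : D.FirstLift :=
  Rd.lift.firstLift h.lift

end N42Readings

end Readings

section Host

variable {D : FinitePlacesDatum}
variable {LH : Type} [NormedAddCommGroup LH] [InnerProductSpace ℂ LH] {Hf : Type} [Group Hf]
  {R : Hf → LH →ₗᵢ[ℂ] LH} {π₀ : Submodule ℂ LH}

/-- THE HOST OBLIGATION OF THE N4.2 BLOCK PER SIDE, OBJECTS — over the N3 side's carriers
`(LH, Hf, R, π₀)` and a first-lift side `F` (TIER5 (E1) as data) under its laws `hF`: the Flath
reading of the datum's local `π`'s (`hIS`) and, at every non-split place, the reading of `F`'s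
global datum through the datum's local objects `(ω_{V₀,v}, π₀,v, β′_v)` (`hFL`). Its laws are
`IsReading`. -/
structure HostReadings (D : FinitePlacesDatum) (F : FirstLiftSide LH Hf R π₀) (hF : F.IsLift) where
  /-- the Flath reading (`hIS`) -/
  flath : FlathReading D
  /-- the reading of `F`'s global datum at every non-split place (`hFL`) -/
  read : ∀ v : D.NonsplitPlace,
    ReadAtPlace (F.toGlobalLiftDatum hF) ((D.towerDatum v).ω 0) (D.towerDatum v).π
      (charLinRep (D.β' v))

namespace HostReadings

variable {F : FirstLiftSide LH Hf R π₀} {hF : F.IsLift} (S : HostReadings D F hF)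

/-- The LAWS of the host readings: the Flath reading's laws, the two sizes, and every reading at a
non-split place is a reading. -/
structure IsReading (S : HostReadings D F hF) : Prop where
  /-- the Flath reading's laws -/
  flath : S.flath.IsReading
  /-- `0 < n` at the split places -/
  pos : ∀ v, 0 < (D.splitDatum v).n
  /-- `n ≤ m` at the split places -/
  sizes : D.TypeIISizes
  /-- the readings' laws -/
  read : ∀ v, (S.read v).IsReading

/-- The first-lift reading of the datum: `F`'s global datum with the readings. -/
def toFirstLiftReading : FirstLiftReading D where
  global := F.toGlobalLiftDatum hF
  read := S.read

/-- … and its laws (the global datum is a lift by `isLift_toGlobalLiftDatum`). -/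
theorem isReading_toFirstLiftReading (hS : S.IsReading) : S.toFirstLiftReading.IsReading where
  global := F.isLift_toGlobalLiftDatum hF
  read := hS.read

/-- The N4.2 readings of the datum from the host readings. -/
def toN42Readings : N42Readings D where
  flath := S.flath
  lift := S.toFirstLiftReading

/-- … and their laws. -/
theorem isReading_toN42Readings (hS : S.IsReading) : S.toN42Readings.IsReading where
  flath := hS.flath
  pos := hS.pos
  sizes := hS.sizes
  lift := S.isReading_toFirstLiftReading hS

/-- `hIS` from the host readings. -/
theorem irreducibleSmooth (hS : S.IsReading) : D.IrreducibleSmooth :=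
  S.flath.irreducibleSmooth hS.flath

/-- `hFL` from the host readings. -/
theorem firstLift (hS : S.IsReading) : D.FirstLift :=
  S.toFirstLiftReading.firstLift (S.isReading_toFirstLiftReading hS)

end HostReadings

end Host

end Summit.Ventures.HodgeRepro2.T6.N42Flath

namespace Summit.Ventures.HodgeRepro2.T6.N42Rich

open Summit.Ventures.HodgeRepro2
open Summit.Ventures.HodgeRepro2.T5TrivialPartner
open Summit.Ventures.HodgeRepro2.T6.N42Defs
open Summit.Ventures.HodgeRepro2.T6.N42Datum
open Summit.Ventures.HodgeRepro2.T6.N42Flath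

section Assembly

variable {D : FinitePlacesDatum}

/-- THE ASSEMBLY: the rich datum of a datum with N4.2 readings (under their laws) — `hIS` and `hFL`
through the two bridges, the sizes from the laws. -/
def ofReadings (Rd : N42Readings D) (h : Rd.IsReading) : N42Rich where
  d := D
  irreducibleSmooth := Rd.irreducibleSmooth h
  pos := h.pos
  typeIISizes := h.sizes
  firstLift := Rd.firstLift h

/-- The assembled rich datum's datum is `D` (`rfl`). -/
theorem ofReadings_toDatum (Rd : N42Readings D) (h : Rd.IsReading) :
    (ofReadings Rd h).toDatum = D := rfl

/-- `N42_main` on a datum with readings: the two displays give `ThetaNonzeroEverywhere`. -/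
theorem thetaNonzeroEverywhere_ofReadings (Rd : N42Readings D) (h : Rd.IsReading)
    (hM : ∀ v, Hyp.Minguez2008_Theoreme1_2 (D.splitDatum v))
    (hGI : ∀ v, Hyp.GanIchino2014_Prop5_3_i (D.towerDatum v)) : D.ThetaNonzeroEverywhere :=
  (ofReadings Rd h).thetaNonzeroEverywhere hM hGI

end Assembly

section Host

variable {D : FinitePlacesDatum}
variable {LH : Type} [NormedAddCommGroup LH] [InnerProductSpace ℂ LH] {Hf : Type} [Group Hf]
  {R : Hf → LH →ₗᵢ[ℂ] LH} {π₀ : Submodule ℂ LH}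

/-- **THE HOST INSTANCE SHAPE**: the rich datum from ONE first-lift side `F` (under its laws) and the
host readings `S` (under theirs) — the `N42Rich` the host's N4.2 block consumes, per side. -/
def ofHost (F : FirstLiftSide LH Hf R π₀) (hF : F.IsLift) (S : HostReadings D F hF)
    (hS : S.IsReading) : N42Rich :=
  ofReadings S.toN42Readings (S.isReading_toN42Readings hS)

/-- The host instance's datum is `D` (`rfl`). -/
theorem ofHost_toDatum (F : FirstLiftSide LH Hf R π₀) (hF : F.IsLift) (S : HostReadings D F hF)
    (hS : S.IsReading) : (ofHost F hF S hS).toDatum = D := rfl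

/-- `N42_main` from the host objects: the two displays give `ThetaNonzeroEverywhere`. -/
theorem thetaNonzeroEverywhere_ofHost (F : FirstLiftSide LH Hf R π₀) (hF : F.IsLift)
    (S : HostReadings D F hF) (hS : S.IsReading)
    (hM : ∀ v, Hyp.Minguez2008_Theoreme1_2 (D.splitDatum v))
    (hGI : ∀ v, Hyp.GanIchino2014_Prop5_3_i (D.towerDatum v)) : D.ThetaNonzeroEverywhere :=
  (ofHost F hF S hS).thetaNonzeroEverywhere hM hGI

variable {K : Type*} [Field K] [NumberField K] [NumberField.IsCMField K]
variable {Fc : FaceSetting K} {P : NDatum Fc}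

/-- THE N4.2 BLOCK OF A COMPOSITION ON SIDE A FROM THE HOST OBJECTS: on the lead's carrier `NAut3`,
a first-lift side and host readings of the side-A datum `M.sA.d42` (under their laws) and the two
displays give `ThetaNonzeroEverywhere` of `M.sA.d42`. -/
theorem N42_side_host₃ (M : NAut3 Fc P) (F : FirstLiftSide LH Hf R π₀) (hF : F.IsLift)
    (S : HostReadings M.sA.d42 F hF) (hS : S.IsReading)
    (hM : ∀ v, Hyp.Minguez2008_Theoreme1_2 (M.sA.d42.splitDatum v))
    (hGI : ∀ v, Hyp.GanIchino2014_Prop5_3_i (M.sA.d42.towerDatum v)) :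
    M.sA.d42.ThetaNonzeroEverywhere :=
  (ofHost F hF S hS).N42_side_rich₃ M rfl hM hGI

/-- The same on side B. -/
theorem N42_sideB_host₃ (M : NAut3 Fc P) (F : FirstLiftSide LH Hf R π₀) (hF : F.IsLift)
    (S : HostReadings M.sB.d42 F hF) (hS : S.IsReading)
    (hM : ∀ v, Hyp.Minguez2008_Theoreme1_2 (M.sB.d42.splitDatum v))
    (hGI : ∀ v, Hyp.GanIchino2014_Prop5_3_i (M.sB.d42.towerDatum v)) :
    M.sB.d42.ThetaNonzeroEverywhere :=
  (ofHost F hF S hS).N42_sideB_rich₃ M rfl hM hGI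

end Host

end Summit.Ventures.HodgeRepro2.T6.N42Rich

/-! ### Toy (§10.5(ii)(c)/(d)): the host shape on the toy first-lift side and the toy datum -/

namespace Summit.Ventures.HodgeRepro2.T6.N42Flath

open Summit.Ventures.HodgeRepro2
open Summit.Ventures.HodgeRepro2.T5DualPairSwap
open Summit.Ventures.HodgeRepro2.T5SplittingTwist
open Summit.Ventures.HodgeRepro2.T5TrivialPartner
open Summit.Ventures.HodgeRepro2.T6.N42Defs
open Summit.Ventures.HodgeRepro2.T6.N42Datum
open Summit.Ventures.HodgeRepro2.T6.N42Toy
open TensorProduct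

/-- The toy first-lift side's representation `πA` is the identity (right translation by `id`). -/
theorem toyFirstLiftSide_πA_eq (g : Unit) :
    toyFirstLiftSide.πA toyFirstLiftSide_isLift g = LinearMap.id := by
  ext v
  simp [FirstLiftSide.πA_apply_coe]

/-- The toy first-lift side's global datum read at the toy datum's one non-split place: trivial away
data, `ι` the projection, `eΩ` / `ePi` the inverses of `TensorProduct.rid` (with `⊤ ≃ ℂ`). -/
noncomputable def toyReadOfSide :
    ReadAtPlace toyGlobalOfSide (toyTower.ω 0) toyTower.π (charLinRep (1 : Unit →* ℂˣ)) where
  G' := Unit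
  A₂ := ℂ
  ω' := Representation.trivial ℂ Unit ℂ
  B₂ := ℂ
  τ₂ := Representation.trivial ℂ Unit ℂ
  ι := MulEquiv.prodUnique
  eΩ := (TensorProduct.rid ℂ ℂ).symm
  ePi := (TensorProduct.congr (Submodule.topEquiv (R := ℂ) (M := ℂ)) (LinearEquiv.refl ℂ ℂ)).trans
    (TensorProduct.rid ℂ (ℂ ⊗[ℂ] ℂ)).symm

/-- … and it is a reading. -/
theorem toyReadOfSide_isReading : toyReadOfSide.IsReading where
  eΩ_intertwining := by
    show Representation.IsIntertwiningMap
      ((Representation.trivial ℂ (Unit × Unit) ℂ).comp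
        (MulEquiv.prodUnique : (Unit × Unit) × Unit ≃* Unit × Unit).toMonoidHom)
      (extTprod (Representation.trivial ℂ (Unit × Unit) ℂ) (Representation.trivial ℂ Unit ℂ))
      (TensorProduct.rid ℂ ℂ).symm.toLinearMap
    refine ⟨fun x u => ?_⟩
    simp [extTprod_apply, TensorProduct.rid_symm_apply, Representation.trivial,
      MulEquiv.prodUnique]
  ePi_intertwining := by
    show Representation.IsIntertwiningMap
      ((extTprod (toyFirstLiftSide.πA toyFirstLiftSide_isLift) (charLinRep (1 : Unit →* ℂˣ))).comp
        (MulEquiv.prodUnique : (Unit × Unit) × Unit ≃* Unit × Unit).toMonoidHom)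
      (extTprod (extTprod (Representation.trivial ℂ Unit ℂ) (charLinRep (1 : Unit →* ℂˣ)))
        (Representation.trivial ℂ Unit ℂ))
      ((TensorProduct.congr (Submodule.topEquiv (R := ℂ) (M := ℂ)) (LinearEquiv.refl ℂ ℂ)).trans
        (TensorProduct.rid ℂ (ℂ ⊗[ℂ] ℂ)).symm).toLinearMap
    refine ⟨fun x u => ?_⟩
    have hχ : ∀ g : Unit, charLinRep (1 : Unit →* ℂˣ) g = LinearMap.id :=
      fun g => LinearMap.ext fun z => by simp [charLinRep_apply]
    have htriv : ∀ g : Unit, Representation.trivial ℂ Unit ℂ g = LinearMap.id := fun _ => rfl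
    simp [extTprod_apply, toyFirstLiftSide_πA_eq, hχ, htriv, MulEquiv.prodUnique]

/-- The toy host readings: the toy Flath reading and the toy reading of the side at the one
non-split place. -/
noncomputable def toyHostReadings :
    HostReadings toyFinitePlaces toyFirstLiftSide toyFirstLiftSide_isLift where
  flath := toyReading
  read := fun _ => toyReadOfSide

/-- … and they satisfy the laws. -/
theorem toyHostReadings_isReading : toyHostReadings.IsReading where
  flath := toyReading_isReading
  pos := fun _ => Nat.zero_lt_succ 1
  sizes := fun _ => Nat.le_succ 2
  read := fun _ => toyReadOfSide_isReading

/-- The toy rich datum assembled from the host shape. -/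
noncomputable def toyRichOfHost : N42Rich :=
  N42Rich.ofHost toyFirstLiftSide toyFirstLiftSide_isLift toyHostReadings toyHostReadings_isReading

/-- Its datum is the toy finite-places datum (`rfl`). -/
theorem toyRichOfHost_toDatum : toyRichOfHost.toDatum = toyFinitePlaces := rfl

/-- The toy's N4.2 conclusion, re-derived from the host shape (§10.5(ii)(d) for this file). -/
theorem toyFinitePlaces_thetaNonzeroEverywhere_host : toyFinitePlaces.ThetaNonzeroEverywhere :=
  toyRichOfHost.thetaNonzeroEverywhere (fun _ => toyTypeII_minguez) (fun _ => toyTower_ganIchino)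

end Summit.Ventures.HodgeRepro2.T6.N42Flath
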